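import Summits.CriticalPhenomena.PercolationContinuityZ3.Theorems.SahiMasterFamilyOrShapeMerged

/-!
# One-coordinate MERGED SECTION CALCULUS for Sahi's `E_k`, every order: `E(U) = Φ⁰(s) + Φ¹(t) − Σ_A Φ⁰_A(s)·Φ¹_{Aᶜ}(t)`

Unit `prim-master-conj` (crux anchor stmt-CriticalPhenomena-4575, helper work), gen 17; memo
`run/shared/lean/prim/prim-l12/prim-master-conj/POINTWISE.md` §18 ("conceptual frame").  Generalises the mechanism of `…OrShapeMerged` from the
OR-shape to an ARBITRARY family.

SETTING.  `p` in the closed cube, `e` a coordinate, `t = p_e`, `s = 1 − t`, `U = (U_0,…,U_n)` ANY events with sections `U^b_j = secAt e b U_j`,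
`ψ_k(x) = (−1)^{k+1} k! C(x,k) = x(1−x)⋯(k−1−x)`.  For a set `τ` of slots and `x ∈ ℝ` put

  `Φ^b_τ(x) := Σ_{T ∈ blockFamilies τ} (∏_{σ∈T} ψ_{|σ|}(x)) · E_{|T|}(μ_p; (1_{⋂_{j∈σ} U^b_j})_{σ∈T})`

— the ψ-weighted MERGED EXPANSION of the sub-family `τ` of the `b`-sections (= Sahi's functional of that sub-family under the SCALED weight `x·μ`;
`Φ^b_∅ = 0`).  THEOREM (`sahiE_eq_merged_sections`, every order, every family):

  `E_{n+1}(μ_p; 1_U) = Φ⁰_{univ}(s) + Φ¹_{univ}(t) − Σ_{A ⊆ slots} Φ⁰_A(s) · Φ¹_{Aᶜ}(t)`   (the extreme terms of the sum vanish).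

PROOF: Sahi's generating function splits along `μ_p = s·μ⁰ + t·μ¹` into the product of the two half-cube generating functions
(`prod_binomB_sections`), each of which is `∏_ω (1 − (1 − (1−X^b_ω)^{x}))^{μ^b(ω)}` (composition law), i.e. the generating function of the universal
merged family with square-zero variables `ψ_{|σ|}(x)·x^σ`; polarisation at every monomial [Sahi2008, Prop. 12; tree `coeff_one_sub_prod_binomB_genB`]
identifies its coefficients with `Φ^b_τ` (`coeff_merged_sections`), and the top coefficient of a product is the convolution.  Reading: `C_k` along one
coordinate ⟺ the "sub-multiplicativity" `Σ_A Φ⁰_A(s)Φ¹_{Aᶜ}(t) ≤ Φ⁰(s) + Φ¹(t)`; the OR-shape theorem (`…OrShapeDomination`) is the case `U¹ = (A¹, Ω,…,Ω)`.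
HONEST FRAMING: an identity; nothing is asserted about `C_k` / `MasterFamilyEqIff k`.  Axioms standard. [this work]
-/

set_option autoImplicit false

open Finset

open private SqFree.ext coeff_add coeff_sub coeff_one coeff_mul coeff_sum coeff_single coeff_C_mul coeff_C coeff_neg
  isNil_single isNil_lin IsNil.add IsNil.sub IsNil.mul_left IsNil.neg IsNil.sum
  binomB_zero_right C_mul_single single_mul_single_self rch_one
  from Literature.Combinatorics.Sahi2008.CumulationCone

open private coeff_genB from Literature.Combinatorics.Sahi2008.GeneratingFunction

noncomputable section

open scoped Classical

namespace Summit.CriticalPhenomena.PercolationContinuityZ3.Theorems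

namespace OrShape

open Function
open Literature.Combinatorics.Sahi2008
open Literature.Combinatorics.Sahi2008.SqFree
open Literature.Probability.Percolation.DecisionTree (ind ind_of_mem ind_of_not_mem ind_nonneg)

section Sections

variable {ι : Type} [Fintype ι] (p : ι → unitInterval) (e : ι) {n : ℕ} (U : Fin (n + 1) → Set (Set ι))

omit [Fintype ι] in
/-- **The universal merged family's square-free element is `1 − (1 − X_ω)^x`**: `Σ_{σ≠∅} ψ_{|σ|}(x)·1_{⋂_σ F}(ω)·x^σ`. [this work] -/
theorem genB_psi_eq (x : ℝ) (F : Fin (n + 1) → Set (Set ι)) (ω : Set ι) :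
    genB (fun (σ : NEFinset (Fin (n + 1))) (ω : Set ι) =>
        ((-1 : ℝ) ^ (σ.1.card + 1) * rch σ.1.card x * (σ.1.card.factorial : ℝ)) * ind (⋂ j ∈ σ.1, F j) ω) ω =
      1 - binomB x (lin (fun j => ind (F j)) ω) := by
  refine SqFree.ext fun τ => ?_
  rw [coeff_genB, one_sub_binomB_lin_coeff]
  by_cases hτ : τ.Nonempty
  · rw [dif_pos hτ, if_neg hτ.ne_empty]
  · rw [dif_neg hτ, if_pos (Finset.not_nonempty_iff_eq_empty.mp hτ)]

/-- Scalars come out of `sahiEOn`: `E_T((c_σ·g_σ)_σ) = (∏_{σ∈T} c_σ)·E_T(g)`. [cite: Sahi2008, p. 211 (multilinearity)] -/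
theorem sahiEOn_smul {V : Type*} (μ : Set ι → ℝ) (T : Finset V) (c : V → ℝ) (g : V → Set ι → ℝ) :
    sahiEOn μ T (fun v => c v • g v) = (∏ v ∈ T, c v) * sahiEOn μ T g := by
  unfold sahiEOn
  rw [show (fun i : Fin T.card => (fun v => c v • g v) ((T.equivFin.symm i : T) : V)) =
      fun i => (fun i => c ((T.equivFin.symm i : T) : V)) i • (fun i => g ((T.equivFin.symm i : T) : V)) i from rfl, sahiE_smul_family]
  congr 1
  rw [← Finset.prod_coe_sort T]
  exact Fintype.prod_equiv T.equivFin.symm _ _ fun i => rfl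

/-- **Coefficients of the half-cube generating function are merged expansions**: for a probability weight `μ` and events `F`,
`[x^τ](1 − ∏_ω (1 − (1 − (1−X_ω)^x))^{μ(ω)}) = Σ_{T ∈ blockFamilies τ} (∏_{σ∈T} ψ_{|σ|}(x))·E_T(μ; (1_{⋂_σ F})_σ)`. [this work] -/
theorem coeff_merged_sections (μ : Set ι → ℝ) (hμ : ∑ ω, μ ω = 1) (x : ℝ) (F : Fin (n + 1) → Set (Set ι)) (τ : Finset (Fin (n + 1))) :
    (1 - ∏ ω, binomB (μ ω) (1 - binomB x (lin (fun j => ind (F j)) ω))).coeff τ =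
      ∑ T ∈ blockFamilies τ, (∏ σ ∈ T, (-1 : ℝ) ^ (σ.1.card + 1) * rch σ.1.card x * (σ.1.card.factorial : ℝ)) *
        sahiEOn μ T (fun (σ : NEFinset (Fin (n + 1))) => ind (⋂ j ∈ σ.1, F j)) := by
  have h := coeff_one_sub_prod_binomB_genB μ hμ (fun (σ : NEFinset (Fin (n + 1))) (ω : Set ι) =>
    ((-1 : ℝ) ^ (σ.1.card + 1) * rch σ.1.card x * (σ.1.card.factorial : ℝ)) * ind (⋂ j ∈ σ.1, F j) ω) τ
  simp only [genB_psi_eq] at h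
  rw [h]
  refine Finset.sum_congr rfl fun T _ => ?_
  exact sahiEOn_smul μ T _ (fun (σ : NEFinset (Fin (n + 1))) => ind (⋂ j ∈ σ.1, F j))

omit [Fintype ι] in
/-- `Σ_x g(x)·[x = univ] = g(univ)`. [folklore] -/
theorem sum_mul_ite_univ (g : Finset (Fin (n + 1)) → ℝ) :
    ∑ x : Finset (Fin (n + 1)), g x * (if x = univ then (1 : ℝ) else 0) = g univ := by
  rw [Finset.sum_eq_single_of_mem (univ : Finset (Fin (n + 1))) (mem_univ _) fun x _ hx => by rw [if_neg hx, mul_zero]]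
  rw [if_pos rfl, mul_one]

omit [Fintype ι] in
/-- `Σ_x [x = ∅]·g(x) = g(∅)`. [folklore] -/
theorem sum_ite_empty_mul (g : Finset (Fin (n + 1)) → ℝ) :
    ∑ x : Finset (Fin (n + 1)), (if x = ∅ then (1 : ℝ) else 0) * g x = g ∅ := by
  rw [Finset.sum_eq_single_of_mem (∅ : Finset (Fin (n + 1))) (mem_univ _) fun x _ hx => by rw [if_neg hx, zero_mul]]
  rw [if_pos rfl, one_mul]

/-- **The generating function splits along `μ_p = s·μ⁰ + t·μ¹`** into the two half-cube generating functions of the sections, each a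
composition `∏_ω (1 − (1 − (1−X^b_ω)^{x}))^{μ^b(ω)}`. [this work] -/
theorem prod_binomB_sections :
    ∏ ω, binomB (bernoulliWeight p ω) (lin (fun j => ind (U j)) ω) =
      (∏ ω, binomB (bernoulliWeight (update p e 0) ω) (1 - binomB (1 - (p e : ℝ)) (lin (fun j => ind (secAt e false (U j))) ω))) *
        ∏ ω, binomB (bernoulliWeight (update p e 1) ω) (1 - binomB (p e : ℝ) (lin (fun j => ind (secAt e true (U j))) ω)) := by
  rw [← Finset.prod_mul_distrib]
  refine Finset.prod_congr rfl fun ω _ => ?_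
  rw [bernoulliWeight_eq_sections p e ω, ← binomB_mul_same (isNil_lin _ ω), binomB_comp (isNil_lin _ ω), binomB_comp (isNil_lin _ ω),
    mul_comm (bernoulliWeight (update p e 0) ω), mul_comm (bernoulliWeight (update p e 1) ω)]
  by_cases he : e ∈ ω
  · rw [bernoulliWeight_update_zero_eq_zero p e he, mul_zero, binomB_zero_left', binomB_zero_left', one_mul, one_mul]
    congr 1
    unfold SqFree.lin
    exact Finset.sum_congr rfl fun j _ => by simp only [SahiComb.ind_secAt_true_of_mem e (U j) he]
  · rw [bernoulliWeight_update_one_eq_zero p e he, mul_zero, binomB_zero_left', binomB_zero_left', mul_one, mul_one]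
    congr 1
    unfold SqFree.lin
    exact Finset.sum_congr rfl fun j _ => by simp only [SahiComb.ind_secAt_false_of_notMem e (U j) he]

/-- Merged section functionals do not depend on `p_e` (sections are `e`-free). [this work] -/
theorem sahiEOn_sections_update_eq (b : Bool) (s' : unitInterval) (T : Finset (NEFinset (Fin (n + 1)))) :
    sahiEOn (bernoulliWeight (update p e s')) T (fun (σ : NEFinset (Fin (n + 1))) => ind (⋂ j ∈ σ.1, secAt e b (U j))) =
      sahiEOn (bernoulliWeight p) T (fun (σ : NEFinset (Fin (n + 1))) => ind (⋂ j ∈ σ.1, secAt e b (U j))) := by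
  unfold sahiEOn
  refine sahiE_ind_update_of_free p e s' (F := fun i => ⋂ j ∈ ((T.equivFin.symm i : T) : NEFinset (Fin (n + 1))).1, secAt e b (U j))
    fun i => ?_
  exact secAt_biInter_free' e (fun j => secAt e b (U j)) (fun j b' => secAt_secAt_eq' e b' b (U j)) false _
where
  /-- Iterated sections at the same coordinate (local copy). [folklore] -/
  secAt_secAt_eq' (e : ι) (b b' : Bool) (X : Set (Set ι)) : secAt e b (secAt e b' X) = secAt e b' X := by
    ext ω
    simp only [mem_secAt]
    have : forceAt e b' (forceAt e b ω) = forceAt e b' ω := by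
      cases b <;> cases b' <;> simp [forceAt]
    rw [this]
  /-- Finite intersections of `e`-free events are `e`-free (local copy). [folklore] -/
  secAt_biInter_free' (e : ι) (B : Fin (n + 1) → Set (Set ι)) (hB : ∀ j (b : Bool), secAt e b (B j) = B j) (b : Bool)
      (ρ : Finset (Fin (n + 1))) : secAt e b (⋂ j ∈ ρ, B j) = ⋂ j ∈ ρ, B j := by
    induction ρ using Finset.induction_on with
    | empty => ext ω; simp [mem_secAt]
    | insert j ρ hj ih =>
      have hsplit : (⋂ j' ∈ insert j ρ, B j') = B j ∩ ⋂ j' ∈ ρ, B j' := by ext ω; simp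
      rw [hsplit, secAt_inter, hB j b, ih]

/-- **ONE-COORDINATE MERGED SECTION CALCULUS, every order, every family of events**:
`E_{n+1}(μ_p; 1_U) = Φ⁰_{univ}(1−p_e) + Φ¹_{univ}(p_e) − Σ_{A} Φ⁰_A(1−p_e)·Φ¹_{Aᶜ}(p_e)` with the merged expansions `Φ^b_τ` of the module
docstring (sum over ALL `A ⊆ slots`; the terms `A = ∅`, `A = univ` vanish). [this work] -/
theorem sahiE_eq_merged_sections :
    sahiE (bernoulliWeight p) (n + 1) (fun j => ind (U j)) =
      (∑ T ∈ blockFamilies (univ : Finset (Fin (n + 1))),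
          (∏ σ ∈ T, (-1 : ℝ) ^ (σ.1.card + 1) * rch σ.1.card (1 - (p e : ℝ)) * (σ.1.card.factorial : ℝ)) *
            sahiEOn (bernoulliWeight p) T (fun (σ : NEFinset (Fin (n + 1))) => ind (⋂ j ∈ σ.1, secAt e false (U j)))) +
      (∑ T ∈ blockFamilies (univ : Finset (Fin (n + 1))),
          (∏ σ ∈ T, (-1 : ℝ) ^ (σ.1.card + 1) * rch σ.1.card (p e : ℝ) * (σ.1.card.factorial : ℝ)) *
            sahiEOn (bernoulliWeight p) T (fun (σ : NEFinset (Fin (n + 1))) => ind (⋂ j ∈ σ.1, secAt e true (U j)))) -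
      ∑ A : Finset (Fin (n + 1)),
        (∑ T ∈ blockFamilies A,
            (∏ σ ∈ T, (-1 : ℝ) ^ (σ.1.card + 1) * rch σ.1.card (1 - (p e : ℝ)) * (σ.1.card.factorial : ℝ)) *
              sahiEOn (bernoulliWeight p) T (fun (σ : NEFinset (Fin (n + 1))) => ind (⋂ j ∈ σ.1, secAt e false (U j)))) *
        (∑ T ∈ blockFamilies Aᶜ,
            (∏ σ ∈ T, (-1 : ℝ) ^ (σ.1.card + 1) * rch σ.1.card (p e : ℝ) * (σ.1.card.factorial : ℝ)) *
              sahiEOn (bernoulliWeight p) T (fun (σ : NEFinset (Fin (n + 1))) => ind (⋂ j ∈ σ.1, secAt e true (U j)))) := by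
  -- the two half-cube products and their coefficients
  set P0 := ∏ ω, binomB (bernoulliWeight (update p e 0) ω) (1 - binomB (1 - (p e : ℝ)) (lin (fun j => ind (secAt e false (U j))) ω)) with hP0
  set P1 := ∏ ω, binomB (bernoulliWeight (update p e 1) ω) (1 - binomB (p e : ℝ) (lin (fun j => ind (secAt e true (U j))) ω)) with hP1
  have hc0 : ∀ A : Finset (Fin (n + 1)), P0.coeff A = (if A = ∅ then (1 : ℝ) else 0) -
      ∑ T ∈ blockFamilies A, (∏ σ ∈ T, (-1 : ℝ) ^ (σ.1.card + 1) * rch σ.1.card (1 - (p e : ℝ)) * (σ.1.card.factorial : ℝ)) *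
        sahiEOn (bernoulliWeight p) T (fun (σ : NEFinset (Fin (n + 1))) => ind (⋂ j ∈ σ.1, secAt e false (U j))) := by
    intro A
    have h := coeff_merged_sections (bernoulliWeight (update p e 0)) (sum_bernoulliWeight _) (1 - (p e : ℝ)) (fun j => secAt e false (U j)) A
    rw [coeff_sub, coeff_one] at h
    simp only [sahiEOn_sections_update_eq p e U false 0] at h
    rw [hP0]; linarith
  have hc1 : ∀ A : Finset (Fin (n + 1)), P1.coeff A = (if A = ∅ then (1 : ℝ) else 0) -
      ∑ T ∈ blockFamilies A, (∏ σ ∈ T, (-1 : ℝ) ^ (σ.1.card + 1) * rch σ.1.card (p e : ℝ) * (σ.1.card.factorial : ℝ)) *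
        sahiEOn (bernoulliWeight p) T (fun (σ : NEFinset (Fin (n + 1))) => ind (⋂ j ∈ σ.1, secAt e true (U j))) := by
    intro A
    have h := coeff_merged_sections (bernoulliWeight (update p e 1)) (sum_bernoulliWeight _) (p e : ℝ) (fun j => secAt e true (U j)) A
    rw [coeff_sub, coeff_one] at h
    simp only [sahiEOn_sections_update_eq p e U true 1] at h
    rw [hP1]; linarith
  -- Sahi's functional as the top coefficient of the product
  rw [sahiE_eq_gfE _ (sum_bernoulliWeight p), gfE, prod_binomB_sections p e U, ← hP0, ← hP1, coeff_sub, coeff_one,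
    if_neg (Finset.univ_nonempty.ne_empty), zero_sub, coeff_mul]
  have hterm : ∀ A ∈ (univ : Finset (Fin (n + 1))).powerset, P0.coeff A * P1.coeff (univ \ A) = P0.coeff A * P1.coeff Aᶜ := by
    intro A _; rw [Finset.compl_eq_univ_sdiff]
  rw [Finset.sum_congr rfl hterm, Finset.powerset_univ]
  simp only [hc0, hc1, sub_mul, mul_sub, Finset.sum_sub_distrib, Finset.compl_eq_empty_iff]
  rw [sum_ite_empty_mul, sum_ite_empty_mul, sum_mul_ite_univ, if_neg (Finset.univ_nonempty.ne_empty).symm, Finset.compl_empty]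
  ring

end Sections

end OrShape
end Summit.CriticalPhenomena.PercolationContinuityZ3.Theorems
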